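import Literature.Computability.QuantumComplexity.CliffordTUniversality
import Literature.Computability.QuantumComplexity.HTCnotUniversalityDensityProofs
import Literature.Computability.QuantumComplexity.BarencoUniversalityProofs
import HarnessLib

/-!
# Universality of Clifford+T and of `{H, T, CNOT}` — the discharges

Sibling proof file of `BQP.lean` / `HTCnotUniversality.lean` / `CliffordTUniversality.lean`
(topic `Literature/Computability/QuantumComplexity`).  With both printed ingredients of the
universality proof of Boykin–Mor–Pulver–Roychowdhury–Vatan (FOCS 1999, §3) now discharged in the
tree —

* `barenco1995_exactUniversality_holds` (`BarencoUniversalityProofs.lean`): exact universality of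
  one-qubit gates with `CNOT` (Barenco et al. 1995, abstract and §8), and
* `boykin1999_HT_generatesDenselyModPhase_holds` (`HTCnotUniversalityDensityProofs.lean`):
  `⟨H, T⟩` is dense in `U(2)` modulo phase (Boykin et al. 1999, §3, first step) —

the proved assemblies `hTCnot_generatesDenselyModPhase_of` (`HTCnotUniversality.lean`) and
`cliffordT_generatesDenselyModPhase_of_hTCnot`, `cliffordT_isUniversal_of`
(`CliffordTUniversality.lean`) yield the unconditional discharges of the three named facts of
`BQP.lean`, **quantum-advantage.S08**:

* `hTCnot_generatesDenselyModPhase_holds` — `{H, T, CNOT}`-placements on `n ≥ 1` wires generate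
  `U(2^n)` densely modulo phase;
* `cliffordT_generatesDenselyModPhase_holds` — the same for the Clifford+T placements
  `{H, S, T, CNOT}`;
* `cliffordT_isUniversal_holds` — `cliffordT.IsUniversal` (threshold `n₀ = 1`).

No definition or named fact is introduced.

## References

* P. O. Boykin, T. Mor, M. Pulver, V. Roychowdhury, F. Vatan, *On universal and fault-tolerant
  quantum computing*, FOCS 1999, 486–494; arXiv:quant-ph/9906054, §3. [Boykin1999FOCS]
* A. Barenco et al., *Elementary gates for quantum computation*, Phys. Rev. A 52 (1995)
  3457–3467, abstract and §8. [BarencoEtAl1995]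
* M. A. Nielsen, I. L. Chuang, *Quantum Computation and Quantum Information*, CUP 2010, §4.5.3.
  [NielsenChuang2010]
-/

namespace Literature.Computability.QuantumComplexity

/-- **Discharge of `hTCnot_generatesDenselyModPhase`** (quantum-advantage.S08, literal form;
Boykin–Mor–Pulver–Roychowdhury–Vatan 1999, §3): for every `n ≥ 1` the placements of `H`, `T`,
`CNOT` on `n` wires, with the global phases, generate a dense subgroup of `U(2^n)`.  Assembly
`hTCnot_generatesDenselyModPhase_of` fed with the two discharged ingredients
`barenco1995_exactUniversality_holds` and `boykin1999_HT_generatesDenselyModPhase_holds`.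
[cite: Boykin1999FOCS, §3] -/
theorem hTCnot_generatesDenselyModPhase_holds : hTCnot_generatesDenselyModPhase :=
  hTCnot_generatesDenselyModPhase_of barenco1995_exactUniversality_holds
    boykin1999_HT_generatesDenselyModPhase_holds

/-- **Discharge of `cliffordT_generatesDenselyModPhase`** (quantum-advantage.S08;
Boykin–Mor–Pulver–Roychowdhury–Vatan 1999, §3; Nielsen–Chuang §4.5.3): for every `n ≥ 1` the
placements of the Clifford+T gates `{H, S, T, CNOT}` on `n` wires generate a dense subgroup of
`U(2^n)` modulo global phase. From the `{H, T, CNOT}` form by monotonicity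
(`cliffordT_generatesDenselyModPhase_of_hTCnot`). [cite: Boykin1999FOCS, §3] -/
theorem cliffordT_generatesDenselyModPhase_holds : cliffordT_generatesDenselyModPhase :=
  cliffordT_generatesDenselyModPhase_of_hTCnot hTCnot_generatesDenselyModPhase_holds

/-- **Discharge of `cliffordT_isUniversal`**: Clifford+T is universal at the placement level
(threshold `n₀ = 1`). [cite: Boykin1999FOCS, §3] -/
theorem cliffordT_isUniversal_holds : cliffordT_isUniversal :=
  cliffordT_isUniversal_of_generatesDenselyModPhase cliffordT_generatesDenselyModPhase_holds

end Literature.Computability.QuantumComplexity
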